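import Summits.KontsevichZagierPeriods.KontsevichZagierPeriods.Theorems.RealEllipticSectorKernel.Negative.Core
import Summits.KontsevichZagierPeriods.KontsevichZagierPeriods.Theorems.EllipticMomentKernel.Negative.GeneralCurve

/-!
# `RealEllipticSectorKernel` (stmt-KontsevichZagierPeriods-10632) — negative knowledge, F13 (part 1,
# roots and ovals): the route's own CM test curve `y² = 4x³ − 120x + 224` (`j = 8000`)

Support file (cdisprove seat, cycle 3; work file `Cruxes/RealEllipticSectorKernel/Disproof.lean`, §12).
THIS FILE: the factorisation `f = 4(x − 4)(x − r₂)(x − r₃)`, located roots, signs, and the typed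
ovals `σ = (r₃, r₂)`, `σ' = (r₂, 4)` (also in the shapes `{f > 0, x < 4}`, `{f < 0, x > 0}` of support
item 3415). The isogeny computation is `Negative/IsogenyCM8000.lean`; the crux-level consequences
`Negative/CMPoint8000.lean`. Overview of F13:
On `f = 4x³ − 120x + 224 = 4(x − 4)(x² + 4x − 14)` (roots `r₃ = −2 − 3√2 < r₂ = −2 + 3√2 < 4`, CM by
`ℤ[√−2]`) the `x`-coordinate of the CM isogeny `[√−2]` is the REAL rational map
`Φ(x) = −x/2 − 9/(x − 4)` with `f(Φx) = −f(x)·Φ′(x)²/2`: it folds the bounded oval `(r₃, r₂)` at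
`x* = 4 − 3√2` and maps each half onto `σ' = (r₂, 4)` with Jacobian weight
`|Φ′|/√(−f(Φx)) = √2/√f(x)`. Hence (two changes of variables, no transcendence)
**`∫_{σ} dx/√f = √2 · ∫_{σ'} dx/√(−f)`**, i.e. `K₀(120,−224) = J₀(120,−224)/√2`
(`CM8000.J_eq_sqrt2_mul_K`; at crux level `CMPoint8000.sqrt_two_mul_K₀`): the crux's inlined
hypothesis FAILS at `j = 8000` with the ALGEBRAIC IRRATIONAL coefficient `√2`
(`not_rigidity_8000`) — the crux is vacuous at the very curve of the route's CM supports, while its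
`ℚ`-sharpening (F4) is not refuted there (no rational relation is produced: `√2 ∉ ℚ`). The same
computation is the VALUE identity behind support item `CMTwistPeriodTransfer` (stmt-…-3415):
`cmTwist_value_eq`, whence `cmTwistPeriodTransfer_of_summit` / `not_summit_of_not_cmTwist` — a proof
of `¬CMTwistPeriodTransfer` would refute the summit (the route's kill criterion, now armed by a
theorem rather than numerics).

References: Silverman, *Advanced Topics* II.2.3 (CM isogeny over `ℝ`); Masser 1975 Ch. III;
Lawden 1989 §6.12.
-/

noncomputable section

namespace Summit.KontsevichZagierPeriods.RealEllipticSectorKernel.CM8000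

open MeasureTheory Set

/-- `f = 4x³ − 120x + 224`. [folklore] -/
def f8 (x : ℝ) : ℝ := 4 * x ^ 3 - 120 * x + 224

/-- `r₂ = −2 + 3√2` (the middle root). [folklore] -/
def r₂ : ℝ := -2 + 3 * Real.sqrt 2

/-- `r₃ = −2 − 3√2` (the smallest root). [folklore] -/
def r₃ : ℝ := -2 - 3 * Real.sqrt 2

/-- `x* = 4 − 3√2` (the fold point of `Φ` on the oval). [folklore] -/
def xs : ℝ := 4 - 3 * Real.sqrt 2

/-- Auxiliary numerics. [folklore] -/
theorem sqrt2_sq : Real.sqrt 2 ^ 2 = 2 := Real.sq_sqrt (by norm_num)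

/-- Auxiliary numerics. [folklore] -/
theorem sqrt2_gt : (1.41 : ℝ) < Real.sqrt 2 := by
  rw [show (1.41 : ℝ) = Real.sqrt (1.41 ^ 2) by rw [Real.sqrt_sq (by norm_num)]]
  exact Real.sqrt_lt_sqrt (by norm_num) (by norm_num)

/-- Auxiliary numerics. [folklore] -/
theorem sqrt2_lt : Real.sqrt 2 < (1.42 : ℝ) := by
  rw [show (1.42 : ℝ) = Real.sqrt (1.42 ^ 2) by rw [Real.sqrt_sq (by norm_num)]]
  exact Real.sqrt_lt_sqrt (by norm_num) (by norm_num)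

/-- `(x − r₂)(x − r₃) = x² + 4x − 14`. [folklore] -/
theorem quad_factor (x : ℝ) : (x - r₂) * (x - r₃) = x ^ 2 + 4 * x - 14 := by
  unfold r₂ r₃; nlinarith [sqrt2_sq]

/-- `f = 4(x − 4)(x − r₂)(x − r₃)`. [folklore] -/
theorem f8_factor (x : ℝ) : f8 x = 4 * (x - 4) * ((x - r₂) * (x - r₃)) := by
  rw [quad_factor]; unfold f8; ring

/-- The factorisation in the shape of the EMK root lemmas: `cubic 120 (−224) = 4(x−r₃)(x−r₂)(x−4)`.
[folklore] -/
theorem cubic_eq (x : ℝ) :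
    Summit.KontsevichZagierPeriods.HermiteRigidity.EllipticMomentKernelNegative.cubic 120 (-224) x =
      4 * (x - r₃) * (x - r₂) * (x - 4) := by
  have h := f8_factor x
  unfold f8 at h
  simp only [Summit.KontsevichZagierPeriods.HermiteRigidity.EllipticMomentKernelNegative.cubic]
  push_cast
  linarith [h, show 4 * (x - 4) * ((x - r₂) * (x - r₃)) = 4 * (x - r₃) * (x - r₂) * (x - 4) by ring]

/-- `cubic 120 (−224) = f` (the crux's `cubic`). [folklore] -/
theorem cubic_eq_f8 (x : ℝ) : Negative.cubic 120 (-224) x = f8 x := by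
  simp only [Negative.cubic, f8]; push_cast; ring

/-- `cubic 120 (−224) = f` (EMK's copy of `cubic`). [folklore] -/
theorem cubic_eq_f8' (x : ℝ) :
    Summit.KontsevichZagierPeriods.HermiteRigidity.EllipticMomentKernelNegative.cubic 120 (-224) x = f8 x := by
  simp only [Summit.KontsevichZagierPeriods.HermiteRigidity.EllipticMomentKernelNegative.cubic, f8]
  push_cast; ring

/-- `r₃ < x*`. [folklore] -/
theorem r₃_lt_xs : r₃ < xs := by unfold r₃ xs; nlinarith [sqrt2_gt]
/-- `x* < r₂`. [folklore] -/
theorem xs_lt_r₂ : xs < r₂ := by unfold r₂ xs; nlinarith [sqrt2_gt]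
/-- `r₂ < 4`. [folklore] -/
theorem r₂_lt_four : r₂ < 4 := by unfold r₂; nlinarith [sqrt2_lt]
/-- `r₃ < r₂`. [folklore] -/
theorem r₃_lt_r₂ : r₃ < r₂ := r₃_lt_xs.trans xs_lt_r₂
/-- `x* < 0`. [folklore] -/
theorem xs_lt_zero : xs < 0 := by unfold xs; nlinarith [sqrt2_gt]
/-- `0 < r₂`. [folklore] -/
theorem zero_lt_r₂ : 0 < r₂ := by unfold r₂; nlinarith [sqrt2_gt]
/-- `r₃ < 0`. [folklore] -/
theorem r₃_lt_zero : r₃ < 0 := by unfold r₃; nlinarith [sqrt2_gt]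

/-- `f > 0` on the oval `(r₃, r₂)`. [folklore] -/
theorem f8_pos_of_mem {x : ℝ} (h3 : r₃ < x) (h2 : x < r₂) : 0 < f8 x := by
  rw [f8_factor, show 4 * (x - 4) * ((x - r₂) * (x - r₃)) = 4 * (4 - x) * ((r₂ - x) * (x - r₃)) by ring]
  have h1 : 0 < 4 - x := by linarith [r₂_lt_four]
  have h2' : 0 < r₂ - x := by linarith
  have h3' : 0 < x - r₃ := by linarith
  positivity

/-- `f < 0` on `σ' = (r₂, 4)`. [folklore] -/
theorem f8_neg_of_mem {x : ℝ} (h2 : r₂ < x) (h4 : x < 4) : f8 x < 0 := by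
  rw [f8_factor]
  have h1 : 0 < 4 - x := by linarith
  have h2' : 0 < x - r₂ := by linarith
  have h3' : 0 < x - r₃ := by linarith [r₃_lt_r₂]
  have : 0 < 4 * (4 - x) * ((x - r₂) * (x - r₃)) := by positivity
  linarith

/-- The typed oval at `(120,−224)`: `{0 < f ∧ ∃ t > x, f t < 0} = (r₃, r₂)`. [folklore] -/
theorem sigma_iff (x : ℝ) : (0 < f8 x ∧ ∃ t : ℝ, x < t ∧ f8 t < 0) ↔ r₃ < x ∧ x < r₂ := by
  constructor
  · rintro ⟨hx, t, hxt, hft⟩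
    have hx' := hx
    rw [← cubic_eq_f8] at hx'
    rcases Summit.KontsevichZagierPeriods.HermiteRigidity.EllipticMomentKernelNegative.mem_Ioo_or_gt_of_cubic_pos
      r₃_lt_r₂ r₂_lt_four cubic_eq hx' with h | h
    · exact h
    · have hft' := hft
      rw [← cubic_eq_f8] at hft'
      exact absurd hft' (not_lt.2
        (Summit.KontsevichZagierPeriods.HermiteRigidity.EllipticMomentKernelNegative.cubic_pos_of_gt
          r₃_lt_r₂ r₂_lt_four cubic_eq (h.trans hxt)).le)
  · rintro ⟨h3, h2⟩
    exact ⟨f8_pos_of_mem h3 h2, 3, by linarith [r₂_lt_four, h2, show r₂ < 3 by unfold r₂; nlinarith [sqrt2_lt]],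
      f8_neg_of_mem (by unfold r₂; nlinarith [sqrt2_lt]) (by norm_num)⟩

/-- `f < 0` forces `x < r₃ ∨ (r₂ < x < 4)`. [folklore] -/
theorem of_f8_neg {x : ℝ} (hx : f8 x < 0) : x < r₃ ∨ (r₂ < x ∧ x < 4) := by
  by_contra hcon
  push Not at hcon
  obtain ⟨h3, h24⟩ := hcon
  rcases lt_or_ge x r₂ with h2 | h2
  · rcases h3.lt_or_eq with h3 | h3
    · linarith [f8_pos_of_mem h3 h2]
    · subst h3
      rw [f8_factor] at hx; simp at hx
  · rcases h2.lt_or_eq with h2 | h2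
    · have h4 := h24 h2
      rcases h4.lt_or_eq with h4 | h4
      · have := Summit.KontsevichZagierPeriods.HermiteRigidity.EllipticMomentKernelNegative.cubic_pos_of_gt
          r₃_lt_r₂ r₂_lt_four cubic_eq h4
        rw [cubic_eq_f8'] at this; linarith
      · subst h4; rw [f8_factor] at hx; simp at hx
    · subst h2; rw [f8_factor] at hx; simp at hx

/-- The typed `σ'` at `(120,−224)`: `{f < 0 ∧ ∃ t < x, 0 < f t} = (r₂, 4)`. [folklore] -/
theorem sigma'_iff (x : ℝ) : (f8 x < 0 ∧ ∃ t : ℝ, t < x ∧ 0 < f8 t) ↔ r₂ < x ∧ x < 4 := by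
  constructor
  · rintro ⟨hx, t, htx, hft⟩
    rcases of_f8_neg hx with h | h
    · exfalso
      have hft' := hft
      rw [← cubic_eq_f8] at hft'
      rcases Summit.KontsevichZagierPeriods.HermiteRigidity.EllipticMomentKernelNegative.mem_Ioo_or_gt_of_cubic_pos
        r₃_lt_r₂ r₂_lt_four cubic_eq hft' with ht | ht
      · linarith [ht.1]
      · linarith [r₃_lt_r₂, r₂_lt_four]
    · exact h
  · rintro ⟨h2, h4⟩
    exact ⟨f8_neg_of_mem h2 h4, 0, by linarith [zero_lt_r₂], f8_pos_of_mem r₃_lt_zero zero_lt_r₂⟩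

/-- `{f < 0 ∧ 0 < x} = (r₂, 4)` (the `σ'` of support item `CMTwistPeriodTransfer`). [folklore] -/
theorem sigma'_iff' (x : ℝ) : (f8 x < 0 ∧ 0 < x) ↔ r₂ < x ∧ x < 4 := by
  constructor
  · rintro ⟨hx, h0⟩
    rcases of_f8_neg hx with h | h
    · linarith [r₃_lt_zero]
    · exact h
  · rintro ⟨h2, h4⟩
    exact ⟨f8_neg_of_mem h2 h4, zero_lt_r₂.trans h2⟩

/-- `{0 < f ∧ x < 4} = (r₃, r₂)` (the `σ` of support item `CMTwistPeriodTransfer`). [folklore] -/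
theorem sigma_iff' (x : ℝ) : (0 < f8 x ∧ x < 4) ↔ r₃ < x ∧ x < r₂ := by
  constructor
  · rintro ⟨hx, h4⟩
    have hx' := hx
    rw [← cubic_eq_f8] at hx'
    rcases Summit.KontsevichZagierPeriods.HermiteRigidity.EllipticMomentKernelNegative.mem_Ioo_or_gt_of_cubic_pos
      r₃_lt_r₂ r₂_lt_four cubic_eq hx' with h | h
    · exact h
    · linarith
  · rintro ⟨h3, h2⟩
    exact ⟨f8_pos_of_mem h3 h2, h2.trans r₂_lt_four⟩

end Summit.KontsevichZagierPeriods.RealEllipticSectorKernel.CM8000
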